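import Mathlib
import Literature.NumberTheory.Irrationality.BrownZudilin2022.GeneralFamily
import HarnessLib

/-!
# ζ(5) search — the Brown–Zudilin group is `S₇` in the symmetric coordinates (certified)

HONEST FRAMING: systematic search; no irrationality claim unless certified.

Cell `pub-zeta5`, seat P1. Brown–Zudilin (arXiv:2210.03391v3, Sects. 8 and 10) introduce symmetric parameters `s₀,…,s₇` with
`a₁ = s₁+s₂, a₂ = s₀-s₂, a₃ = s₂+s₃, a₄ = s₀-s₃, a₅ = s₃+s₄, a₆ = s₅+s₆, a₇ = s₆+s₇, a₈ = s₃+s₅` and state that their group `G`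
(generated by `i₁, p₀₁, p₁₂, h`) "acts on `a` via the group `S₇` which permutes `s₁,…,s₇` and fixes `s₀`", whence `|G| = 7!`.
For the typed generators of `Literature.NumberTheory.Irrationality.BrownZudilin2022.GeneralFamily` this file PROVES:

* `aOf` — the linear map `s ↦ a` above (on `Fin 8 → ℤ`), and `aOf_injective`;
* `genI1_aOf`, `genP01_aOf`, `genP12_aOf`, `genH_aOf`, `genH'_aOf` — each generator acts on `a = aOf s` by permuting `s₁,…,s₇`
  (fixing `s₀`): `i₁ ↔ (s₁ s₄)(s₂ s₃)(s₅ s₇)`, `p₀₁ ↔ (s₃ s₄)`, `p₁₂ ↔ (s₃ s₅)`, `h ↔ (s₃ s₆)`, `h' ↔ (s₄ s₆)` — identities of linear maps,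
  all `s`;
* `closure_eq_top` — the five permutations of `{s₁,…,s₇}` (as `Equiv.Perm (Fin 7)`, index `j ↔ s_{j+1}`) generate the full symmetric
  group `S₇` (via Mathlib's `closure_cycle_adjacent_swap`: the 7-cycle `finRotate 7` and the transposition `(s₁ s₂)` are explicit words in
  the generators, checked by `decide`).

Consequently the action of `G` on the (Zariski-dense, `aOf`-injective) family `a = aOf s` is that of `S₇` on `s₁,…,s₇`, in particular
`|G| = 7! = 5040` as asserted in the source (Remark 4, Sect. 8); the abstract isomorphism statement is not spelled out here.
-/

namespace Summit.KontsevichZagierPeriods.Zeta5Search.CellularGroup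

open Equiv
open Literature.NumberTheory.Irrationality.BrownZudilin2022

/-! ### The symmetric coordinates -/

/-- `a = aOf s`: `a₁ = s₁+s₂, a₂ = s₀-s₂, a₃ = s₂+s₃, a₄ = s₀-s₃, a₅ = s₃+s₄, a₆ = s₅+s₆, a₇ = s₆+s₇, a₈ = s₃+s₅` (BZ Sect. 10;
stated over `ℤ` — the genuine symmetric parameters of an integer `a` are half-integers, which does not affect these linear identities). -/
def aOf (s : Fin 8 → ℤ) : Fin 8 → ℤ :=
  ![s 1 + s 2, s 0 - s 2, s 2 + s 3, s 0 - s 3, s 3 + s 4, s 5 + s 6, s 6 + s 7, s 3 + s 5]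

/-- `aOf` is injective (inverse formulas of BZ Sect. 10: `2s₀ = a₂+a₃+a₄`, …). -/
theorem aOf_injective : Function.Injective aOf := by
  intro s t h
  have e : ∀ i, aOf s i = aOf t i := fun i => congrFun h i
  have e0 := e 0; have e1 := e 1; have e2 := e 2; have e3 := e 3
  have e4 := e 4; have e5 := e 5; have e6 := e 6; have e7 := e 7
  simp [aOf] at e0 e1 e2 e3 e4 e5 e6 e7
  funext i
  fin_cases i <;> simp <;> omega

/-! ### The generators permute the symmetric coordinates -/

/-- `i₁(aOf s) = aOf(s₀, s₄, s₃, s₂, s₁, s₇, s₆, s₅)`: `i₁ ↔ (s₁ s₄)(s₂ s₃)(s₅ s₇)`. -/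
theorem genI1_aOf (s : Fin 8 → ℤ) :
    genI1 (aOf s) = aOf ![s 0, s 4, s 3, s 2, s 1, s 7, s 6, s 5] := by
  funext i; fin_cases i <;> simp [genI1, aOf] <;> ring

/-- `p₀₁(aOf s) = aOf(s with s₃ ↔ s₄)`. -/
theorem genP01_aOf (s : Fin 8 → ℤ) :
    genP01 (aOf s) = aOf ![s 0, s 1, s 2, s 4, s 3, s 5, s 6, s 7] := by
  funext i; fin_cases i <;> simp [genP01, aOf] <;> ring

/-- `p₁₂(aOf s) = aOf(s with s₃ ↔ s₅)`. -/
theorem genP12_aOf (s : Fin 8 → ℤ) :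
    genP12 (aOf s) = aOf ![s 0, s 1, s 2, s 5, s 4, s 3, s 6, s 7] := by
  funext i; fin_cases i <;> simp [genP12, aOf] <;> ring

/-- `h(aOf s) = aOf(s with s₃ ↔ s₆)`. -/
theorem genH_aOf (s : Fin 8 → ℤ) :
    genH (aOf s) = aOf ![s 0, s 1, s 2, s 6, s 4, s 5, s 3, s 7] := by
  funext i; fin_cases i <;> simp [genH, aOf] <;> ring

/-- `h'(aOf s) = aOf(s with s₄ ↔ s₆)`. -/
theorem genH'_aOf (s : Fin 8 → ℤ) :
    genH' (aOf s) = aOf ![s 0, s 1, s 2, s 3, s 6, s 5, s 4, s 7] := by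
  funext i; fin_cases i <;> simp [genH', aOf] <;> ring

/-! ### The permutations generate `S₇` -/

/-- The permutation of `{s₁,…,s₇}` induced by `i₁`, on `Fin 7` (index `j ↔ s_{j+1}`): `(0 3)(1 2)(4 6)`. -/
def permI1 : Perm (Fin 7) := swap 0 3 * swap 1 2 * swap 4 6

/-- The generating set `{(0 3)(1 2)(4 6), (2 3), (2 4), (2 5), (3 5)}` = the permutations of `i₁, p₀₁, p₁₂, h, h'`. -/
def genSet : Set (Perm (Fin 7)) := {permI1, swap 2 3, swap 2 4, swap 2 5, swap 3 5}

/-- The 7-cycle `finRotate 7` as a word in the generators. -/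
theorem finRotate_eq_word :
    finRotate 7 = swap 2 5 * swap 2 4 * swap 2 3 * permI1 * swap 2 3 * swap 2 4 * swap 2 5 * permI1 := by
  unfold permI1; decide

/-- The transposition `(0 1)` as a word in the generators. -/
theorem swap01_eq_word : swap (0 : Fin 7) 1 = permI1 * swap 2 3 * permI1 := by
  unfold permI1; decide

/-- **The five permutations generate `S₇`.** -/
theorem closure_eq_top : Subgroup.closure genSet = ⊤ := by
  have hI : permI1 ∈ Subgroup.closure genSet := Subgroup.subset_closure (by simp [genSet])
  have h23 : swap (2 : Fin 7) 3 ∈ Subgroup.closure genSet := Subgroup.subset_closure (by simp [genSet])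
  have h24 : swap (2 : Fin 7) 4 ∈ Subgroup.closure genSet := Subgroup.subset_closure (by simp [genSet])
  have h25 : swap (2 : Fin 7) 5 ∈ Subgroup.closure genSet := Subgroup.subset_closure (by simp [genSet])
  have hc : finRotate 7 ∈ Subgroup.closure genSet := by
    rw [finRotate_eq_word]
    exact Subgroup.mul_mem _ (Subgroup.mul_mem _ (Subgroup.mul_mem _ (Subgroup.mul_mem _
      (Subgroup.mul_mem _ (Subgroup.mul_mem _ (Subgroup.mul_mem _ h25 h24) h23) hI) h23) h24) h25) hI
  have hs : swap (0 : Fin 7) (finRotate 7 0) ∈ Subgroup.closure genSet := by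
    rw [show finRotate 7 0 = (1 : Fin 7) by decide, swap01_eq_word]
    exact Subgroup.mul_mem _ (Subgroup.mul_mem _ hI h23) hI
  have htop := Perm.closure_cycle_adjacent_swap (isCycle_finRotate_of_le (by norm_num)) (by simp) (0 : Fin 7)
  refine le_antisymm le_top ?_
  rw [← htop]
  exact (Subgroup.closure_le _).2 (Set.insert_subset hc (Set.singleton_subset_iff.2 hs))

end Summit.KontsevichZagierPeriods.Zeta5Search.CellularGroup
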